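import Literature.NumberTheory.Transcendental.L2HodgeTheory
import Literature.Geometry.Kaehler.RiemannianHodgeAdjointProofs
import HarnessLib

/-!
# The Hodge Laplacian is symmetric in `L²` (Warner, Prop. 6.2, Corollary)

Topic: real `L²` Hodge theory on a closed oriented Riemannian manifold
(`Literature/NumberTheory/Transcendental/L2HodgeTheory.lean`: the `L²` inner product
`Literature.Geometry.Kaehler.MForm.l2Inner o α β = ∫_M ⟪α, β⟫ vol_o` and the named fact
`Literature.NumberTheory.Transcendental.l2Inner_hodgeLaplacian_comm`). Source: F. W. Warner,
*Foundations of Differentiable Manifolds and Lie Groups*, GTM 94 (1983), Ch. 6, where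
"throughout this chapter, `M` will be a compact oriented Riemannian manifold of dimension `n`"
(p. 220), `⟨α, β⟩ = ∫_M α ∧ *β` (6.1 (5)), Prop. 6.2 `⟨dα, β⟩ = ⟨α, δβ⟩` and its Corollary (5),
p. 221: "`Δ` is self-adjoint, that is, `⟨Δα, β⟩ = ⟨α, Δβ⟩ (α, β ∈ E^p(M); 0 ≤ p ≤ n)`".

## Main statements (all proved)

* `Literature.Geometry.Kaehler.MForm.l2Inner_add_left_of_isSmoothForm`: additivity of `⟪·, ·⟫_{L²}`
  on smooth forms of a compact manifold. (Prop. 6.2 (1) in `L²` form, `⟪dβ, γ⟫ = ⟪β, δγ⟫`, is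
  `MForm.l2Inner_mextDeriv_left_of_isSmoothForm` of the sibling file
  `L2HodgeTheoryExactCoexactProofs.lean` — the wedge identity `integral_mextDeriv_wedge_hodgeStar`
  of `RiemannianHodgeAdjointProofs.lean` read through `MForm.wedge_hodgeStar`; a three-line
  `private` copy is used below so that this file depends only on the latter.)
* `Literature.NumberTheory.Transcendental.l2Inner_hodgeLaplacian_left_eq`: the polarised energy
  identity `⟪Δα, β⟫ = ⟪δα, δβ⟫ + ⟪dα, dβ⟫` (Warner, proof of Prop. 6.3, (1)).
* `Literature.NumberTheory.Transcendental.l2Inner_hodgeLaplacian_comm_of_isSmoothForm` —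
  **Prop. 6.2, Corollary**: `⟪Δα, β⟫ = ⟪α, Δβ⟫` for smooth `k`-forms on a closed oriented
  Riemannian manifold, in every degree pattern of `hodgeLaplacian`.
* `Literature.NumberTheory.Transcendental.l2Inner_hodgeLaplacian_comm_of_compactSpace`: under the
  intended instances `[CompactSpace M] [I.Boundaryless] [IsContinuousRiemannianBundle …]
  [IsContMDiffRiemannianBundle I ∞ …]` the named fact `l2Inner_hodgeLaplacian_comm o` *as
  declared* holds.
* (Appended.) The Corollary as a *closed* named fact, correctly hypothesised,
  `Literature.NumberTheory.Transcendental.l2Inner_hodgeLaplacian_comm_of_isClosedManifold`, and its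
  discharge `…_holds`.

## Correction of `l2Inner_hodgeLaplacian_comm` (provefact pass, 2026-08-15)

The named fact `Literature.NumberTheory.Transcendental.l2Inner_hodgeLaplacian_comm` is a
`def … : Prop` written inside `section Closed` of `L2HodgeTheory.lean`, after
`variable [CompactSpace M] [I.Boundaryless] [IsContinuousRiemannianBundle E _]
[IsContMDiffRiemannianBundle I ∞ E _]`. A `def` abstracts only the section variables its body
*uses*, and none of these four instances is used by `l2Inner`, `hodgeLaplacian` or `IsSmoothForm`:
the elaborated constant binds exactly
`[FiniteDimensional ℝ E] [Fact (finrank ℝ E = n)] [MeasurableSpace E] [BorelSpace E] [T2Space M]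
[SigmaCompactSpace M] [IsManifold I ∞ M] [RiemannianBundle _] (o) {k m}` (checked by printing
its type). As elaborated it therefore asserts the symmetry `⟪Δα, β⟫ = ⟪α, Δβ⟫` for *every*
Hausdorff σ-compact `C^∞` manifold — non-compact ones and manifolds with boundary included — and
for fibre metrics of no regularity, whereas Warner's Corollary is about compact oriented
Riemannian manifolds (without boundary, smooth metric). In that generality the statement is
**false**. On `M = ℝ` (model `𝓘(ℝ, ℝ)`, `n = 1`, `k = 0`, `m = 1`, the flat metric, the constant
orientation, whose volume form `dx` is smooth) take the smooth `0`-forms `α = 1` and `β = g` with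
`g' = ` a smooth transition function (`g' = 0` on `(-∞, 0]`, `g' = 1` on `[1, ∞)`), so that `g''`
is a non-negative bump with `∫ g'' = 1`. Then `Δα = δ d 1 = 0`, so `⟪Δα, β⟫ = 0`; but
`Δβ = δ d g = -g''` and `⟪α, Δβ⟫ = ∫_ℝ (-g'') vol`: the integrand is a *compactly supported* smooth
top form, so in `MForm.integral` (the `finsum` over the chosen partition of unity `ρ`, subordinate
to the chart sources, of the chart integrals `∫ sign · ρᵢ · (-g'') dλ`) only the finitely many `i`
with `supp ρᵢ ∩ supp g'' ≠ ∅` contribute (local finiteness), each chart integral is a genuine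
integral of a continuous compactly supported function, and `∑ᵢ ρᵢ = 1` gives
`⟪α, Δβ⟫ = -sign · c · ∫ g'' dλ ≠ 0` (`c ≠ 0` the value of `vol` on the reference frame). No junk
value rescues the identity. (With boundary it fails already on `[0, 1]`: `∫₀¹ g'' = g'(1) - g'(0)`.)
Following the provefact protocol (a mis-stated named fact is corrected under a new name, never
edited in place), the Corollary is re-vendored here as the closed statement
`l2Inner_hodgeLaplacian_comm_of_isClosedManifold` with
`[CompactSpace M] [I.Boundaryless] [IsContinuousRiemannianBundle E _]
[IsContMDiffRiemannianBundle I ∞ E _]` bound *inside* the statement, and discharged. The same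
dropped-instance defect affects the sibling facts `MForm.l2Inner_add_left`,
`MForm.l2Inner_self_eq_zero_iff`, `MForm.l2Inner_mextDeriv_left`,
`l2Inner_hodgeLaplacian_self_nonneg` of `L2HodgeTheory.lean` (their usable compact forms are, or
follow from, the theorems below); `MForm.l2Inner_eq_integral_wedge_hodgeStar` needs no compactness
(it is discharged in `L2HodgeTheoryProofs.lean`; here the pointwise identity `MForm.wedge_hodgeStar`
of `HodgeStarWedge.lean` is used directly).

## Proof (as printed, Warner p. 221)

`⟨Δα, β⟩ = ⟨dδα, β⟩ + ⟨δdα, β⟩ = ⟨δα, δβ⟩ + ⟨dα, dβ⟩` by Prop. 6.2 twice (once read backwards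
through the symmetry of `⟨·, ·⟩`), an expression symmetric in `(α, β)`. The `L²` products are
integrals of `⟪·, ·⟫ vol = · ∧ ⋆·` (`MForm.wedge_hodgeStar`), so Prop. 6.2 is the wedge identity
`∫_M dβ ∧ ⋆γ = ∫_M β ∧ ⋆δγ` (`integral_mextDeriv_wedge_hodgeStar`, from the Leibniz rule,
`d⋆ = ±⋆δ` and Stokes `∫_M d(β ∧ ⋆γ) = 0`), and additivity of `∫_M` on smooth top forms is
`MForm.integral_add_holds`. In the degenerate degree patterns of `hodgeLaplacian`
(`(0, 0)`: `Δ = 0`; `(0, m+1)`: `Δ = δd`; `(k+1, 0)`: `Δ = dδ`) one of the two energies is absent.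

## References

* F. W. Warner, *Foundations of Differentiable Manifolds and Lie Groups*, GTM 94, Springer (1983):
  6.1 (p. 220), Prop. 6.2 and Corollary (5) (pp. 220–221), proof of Prop. 6.3 (1) (p. 221).
* J. Jost, *Riemannian Geometry and Geometric Analysis*, §3.3 (Cor. 3.3.1).

## Verdict clean-up note (2026-08-15)

The named fact `l2Inner_hodgeLaplacian_comm` is now an `@[deprecated]` record of
`L2HodgeTheory.lean` (mis-stated, resp. refuted as stated: a `def` does not abstract the unused
section instances it was written under; the corrected statements are the ones proved or named in
this file and in the records' docstrings). The declaration
`l2Inner_hodgeLaplacian_comm_of_compactSpace` names the record on purpose, so `linter.deprecated` is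
silenced on exactly that declaration (REMOVE-WHEN the records are deleted from
`L2HodgeTheory.lean`).
-/

noncomputable section

open scoped Manifold ContDiff Topology
open Bundle Module
open Literature.Geometry.Kaehler
open Literature.Geometry.Kaehler.MForm

namespace Literature.NumberTheory.Transcendental

variable {E : Type*} [NormedAddCommGroup E] [NormedSpace ℝ E] [FiniteDimensional ℝ E]
  {n : ℕ} [Fact (finrank ℝ E = n)]
  {H : Type*} [TopologicalSpace H] {I : ModelWithCorners ℝ E H}
  {M : Type*} [TopologicalSpace M] [ChartedSpace H M] [IsManifold I ∞ M]
  [RiemannianBundle (fun x : M ↦ TangentSpace I x)]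
  (o : (x : M) → Orientation ℝ (TangentSpace I x) (Fin n)) {k m : ℕ}

/-! ### The integrand `⟪α, β⟫ vol` -/

omit [IsManifold I ∞ M] in
/-- The pointwise inner product of forms is additive on the left:
`⟪α₁ + α₂, β⟫_x = ⟪α₁, β⟫_x + ⟪α₂, β⟫_x` (bilinearity of `alternatingFormInner`;
Warner (1983), Ex. 2.13). [folklore] -/
theorem _root_.Literature.Geometry.Kaehler.MForm.inner_add_left (α₁ α₂ β : MForm I M ℝ k) (x : M) :
    MForm.inner n (α₁ + α₂) β x = MForm.inner n α₁ β x + MForm.inner n α₂ β x := by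
  simp only [MForm.inner, Pi.add_apply, map_add, LinearMap.add_apply]

omit [IsManifold I ∞ M] in
/-- The pointwise inner product of forms is symmetric, `⟪α, β⟫_x = ⟪β, α⟫_x`
(`isSymm_alternatingFormInner`; Warner (1983), Ex. 2.13). [folklore] -/
theorem _root_.Literature.Geometry.Kaehler.MForm.inner_comm (α β : MForm I M ℝ k) (x : M) :
    MForm.inner n α β x = MForm.inner n β α x :=
  (isSymm_alternatingFormInner (V := TangentSpace I x) (n := n) k).eq (α x) (β x)

/-- On an oriented Riemannian manifold with smooth metric (`vol_o` smooth), the top form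
`x ↦ ⟪α, β⟫_x vol_o(x)` of two smooth `k`-forms (`k + m = n`) is smooth: it is the degree cast of
`α ∧ ⋆β` (`MForm.wedge_hodgeStar`), a wedge of smooth forms (`IsSmoothFormWedge_holds`,
`IsSmoothForm.hodgeStar`). Warner (1983), 6.1. [cite: WarnerGTM94, 6.1, p. 220] -/
theorem isSmoothForm_inner_smul_riemannianVolumeForm
    [IsContMDiffRiemannianBundle I ∞ E (fun x : M ↦ TangentSpace I x)]
    (ho : IsSmoothForm (riemannianVolumeForm o)) (h : k + m = n) {α β : MForm I M ℝ k}
    (hα : IsSmoothForm α) (hβ : IsSmoothForm β) :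
    IsSmoothForm (fun x ↦ MForm.inner n α β x • riemannianVolumeForm o x) := by
  rw [← MForm.wedge_hodgeStar o h α β]
  exact isSmoothForm_castDeg _
    (IsSmoothFormWedge_holds (I := I) (M := M) (A := ℝ) hα (IsSmoothForm.hodgeStar o ho h hβ))

/-! ### The `L²` product: `⟪0, β⟫ = 0` and additivity -/

section Integral

variable [MeasurableSpace E] [BorelSpace E] [T2Space M]

/-- `⟪0, β⟫_{L²} = 0` (unconditionally, from `MForm.l2Inner_smul_left` with the scalar `0`).
[folklore] -/
theorem l2Inner_zero_left_eq [SigmaCompactSpace M] (β : MForm I M ℝ k) :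
    l2Inner o (0 : MForm I M ℝ k) β = 0 := by
  simpa using MForm.l2Inner_smul_left o (0 : ℝ) (0 : MForm I M ℝ k) β

variable [CompactSpace M] [I.Boundaryless]
  [IsContinuousRiemannianBundle E (fun x : M ↦ TangentSpace I x)]
  [IsContMDiffRiemannianBundle I ∞ E (fun x : M ↦ TangentSpace I x)]

omit [I.Boundaryless] in
/-- **Additivity of the `L²` product on the left** for smooth `k`-forms (`k + m = n`) of a compact
oriented Riemannian manifold (smooth metric, `vol_o` smooth):
`⟪α₁ + α₂, β⟫ = ⟪α₁, β⟫ + ⟪α₂, β⟫` — pointwise bilinearity and the additivity of `∫_M` on smooth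
top forms (`MForm.integral_add_holds`, through the bridge
`isContinuousOrientation_of_isSmoothForm_riemannianVolumeForm_holds`). This is the compact form of
the (over-general) named fact `MForm.l2Inner_add_left`. Warner (1983), 6.1 (5) ("bilinear form"),
p. 220. [cite: WarnerGTM94, 6.1 (5), p. 220] -/
theorem _root_.Literature.Geometry.Kaehler.MForm.l2Inner_add_left_of_isSmoothForm
    (ho : IsSmoothForm (riemannianVolumeForm o)) (h : k + m = n) {α₁ α₂ β : MForm I M ℝ k}
    (hα₁ : IsSmoothForm α₁) (hα₂ : IsSmoothForm α₂) (hβ : IsSmoothForm β) :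
    l2Inner o (α₁ + α₂) β = l2Inner o α₁ β + l2Inner o α₂ β := by
  have hoc : IsContinuousOrientation o :=
    isContinuousOrientation_of_isSmoothForm_riemannianVolumeForm_holds o ho
  unfold MForm.l2Inner
  rw [← MForm.integral_add_holds o hoc (isSmoothForm_inner_smul_riemannianVolumeForm o ho h hα₁ hβ)
    (isSmoothForm_inner_smul_riemannianVolumeForm o ho h hα₂ hβ)]
  congr 1
  funext x
  rw [Pi.add_apply, MForm.inner_add_left, add_smul]

/-- `⟪dβ, γ⟫ = ⟪β, δγ⟫` (Warner (1983), Prop. 6.2 (1), p. 221): a `private` copy of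
`MForm.l2Inner_mextDeriv_left_of_isSmoothForm` (`L2HodgeTheoryExactCoexactProofs.lean`) — the
wedge identity `integral_mextDeriv_wedge_hodgeStar` with both integrands rewritten by
`MForm.wedge_hodgeStar`. [cite: WarnerGTM94, Prop. 6.2, p. 221] -/
private theorem l2Inner_mextDeriv_left_aux (ho : IsSmoothForm (riemannianVolumeForm o))
    {j l : ℕ} (hγ : (j + 1) + l = n) {β : MForm I M ℝ j} {γ : MForm I M ℝ (j + 1)}
    (hβ : IsSmoothForm β) (hγs : IsSmoothForm γ) :
    l2Inner o (mextDeriv β) γ = l2Inner o β (mcoderiv o hγ γ) := by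
  have h1 := integral_mextDeriv_wedge_hodgeStar o ho hγ hβ hγs
  rw [MForm.wedge_hodgeStar, MForm.wedge_hodgeStar] at h1
  exact h1

/-! ### Warner's Corollary to Prop. 6.2: `Δ` is symmetric -/

/-- **The polarised energy identity** `⟪Δα, β⟫ = ⟪δα, δβ⟫ + ⟪dα, dβ⟫` for smooth `(k+1)`-forms on
a closed oriented Riemannian manifold, in the generic degree pattern `(k + 1) + (m + 1) = n` of
`hodgeLaplacian` (`Δ = dδ + δd`): `⟪dδα, β⟫ = ⟪δα, δβ⟫` and `⟪δdα, β⟫ = ⟪β, δdα⟫ = ⟪dβ, dα⟫` by the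
adjointness `MForm.l2Inner_mextDeriv_left_of_isSmoothForm` (Prop. 6.2) and the symmetry of
`⟪·, ·⟫`. Warner (1983), proof of Prop. 6.3, (1), p. 221 (there with `β = α`).
[cite: WarnerGTM94, Prop. 6.3 (1), p. 221] -/
theorem l2Inner_hodgeLaplacian_left_eq (ho : IsSmoothForm (riemannianVolumeForm o))
    (h : (k + 1) + (m + 1) = n) {α β : MForm I M ℝ (k + 1)} (hα : IsSmoothForm α)
    (hβ : IsSmoothForm β) :
    l2Inner o (hodgeLaplacian o (k + 1) (m + 1) h α) β =
      l2Inner o (mcoderiv o h α) (mcoderiv o h β) + l2Inner o (mextDeriv α) (mextDeriv β) := by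
  have h2 : (k + 1 + 1) + m = n := by omega
  have hδα : IsSmoothForm (mcoderiv o h α) := IsSmoothForm.mcoderiv o ho h hα
  have hdα : IsSmoothForm (mextDeriv α) := isSmoothForm_mextDeriv (inChart_mextDeriv_holds I M ℝ) hα
  have hdδα : IsSmoothForm (mextDeriv (mcoderiv o h α)) :=
    isSmoothForm_mextDeriv (inChart_mextDeriv_holds I M ℝ) hδα
  have hδdα : IsSmoothForm (mcoderiv o h2 (mextDeriv α)) := IsSmoothForm.mcoderiv o ho h2 hdα
  have hΔ : hodgeLaplacian o (k + 1) (m + 1) h α =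
      mextDeriv (mcoderiv o h α) + mcoderiv o h2 (mextDeriv α) := rfl
  rw [hΔ, MForm.l2Inner_add_left_of_isSmoothForm o ho h hdδα hδdα hβ,
    l2Inner_mextDeriv_left_aux o ho h hδα hβ,
    MForm.l2Inner_symm o (mcoderiv o h2 (mextDeriv α)) β,
    ← l2Inner_mextDeriv_left_aux o ho h2 hβ hdα,
    MForm.l2Inner_symm o (mextDeriv β) (mextDeriv α)]

/-- **The Hodge Laplacian is symmetric** (Warner (1983), Prop. 6.2, Corollary (5), p. 221):
`⟪Δα, β⟫ = ⟪α, Δβ⟫` for smooth `k`-forms `α`, `β` (`k + m = n`) on a compact oriented Riemannian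
manifold without boundary — Hausdorff `C^∞` manifold, `C^∞` metric, `vol_o` smooth (`o` locally
constant). Proof as printed: `⟪Δα, β⟫ = ⟪δα, δβ⟫ + ⟪dα, dβ⟫` (`l2Inner_hodgeLaplacian_left_eq`),
symmetric in `(α, β)`; in the degree patterns `(0, 0)` (`Δ = 0`), `(0, m+1)` (`Δ = δd`) and
`(k+1, 0)` (`Δ = dδ`) of `hodgeLaplacian` the same computation has a single term.
[cite: WarnerGTM94, Prop. 6.2 Corollary, p. 221] -/
theorem l2Inner_hodgeLaplacian_comm_of_isSmoothForm (ho : IsSmoothForm (riemannianVolumeForm o))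
    (h : k + m = n) {α β : MForm I M ℝ k} (hα : IsSmoothForm α) (hβ : IsSmoothForm β) :
    l2Inner o (hodgeLaplacian o k m h α) β = l2Inner o α (hodgeLaplacian o k m h β) := by
  have hd : ∀ {j : ℕ} {γ : MForm I M ℝ j}, IsSmoothForm γ → IsSmoothForm (mextDeriv γ) :=
    fun hγ ↦ isSmoothForm_mextDeriv (inChart_mextDeriv_holds I M ℝ) hγ
  rcases k with - | k <;> rcases m with - | m
  · -- `n = 0`: `Δ = 0`
    have hΔ : ∀ γ : MForm I M ℝ 0, hodgeLaplacian o 0 0 h γ = 0 := fun γ ↦ rfl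
    rw [hΔ, hΔ, MForm.l2Inner_symm o α, l2Inner_zero_left_eq, l2Inner_zero_left_eq]
  · -- functions: `Δ = δd`, `⟪δdα, β⟫ = ⟪dα, dβ⟫`
    have h1 : (0 + 1) + m = n := by omega
    have hΔ : ∀ γ : MForm I M ℝ 0, hodgeLaplacian o 0 (m + 1) h γ = mcoderiv o h1 (mextDeriv γ) :=
      fun γ ↦ rfl
    rw [hΔ, hΔ, MForm.l2Inner_symm o _ β,
      ← l2Inner_mextDeriv_left_aux o ho h1 hβ (hd hα),
      ← l2Inner_mextDeriv_left_aux o ho h1 hα (hd hβ),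
      MForm.l2Inner_symm o (mextDeriv β) (mextDeriv α)]
  · -- top degree: `Δ = dδ`, `⟪dδα, β⟫ = ⟪δα, δβ⟫`
    have hΔ : ∀ γ : MForm I M ℝ (k + 1), hodgeLaplacian o (k + 1) 0 h γ =
        mextDeriv (mcoderiv o h γ) := fun γ ↦ rfl
    rw [hΔ, hΔ, l2Inner_mextDeriv_left_aux o ho h
        (IsSmoothForm.mcoderiv o ho h hα) hβ,
      MForm.l2Inner_symm o α,
      l2Inner_mextDeriv_left_aux o ho h (IsSmoothForm.mcoderiv o ho h hβ) hα,
      MForm.l2Inner_symm o (mcoderiv o h β) (mcoderiv o h α)]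
  · -- generic degrees: `Δ = dδ + δd`
    rw [l2Inner_hodgeLaplacian_left_eq o ho h hα hβ, MForm.l2Inner_symm o α,
      l2Inner_hodgeLaplacian_left_eq o ho h hβ hα, MForm.l2Inner_symm o (mcoderiv o h β),
      MForm.l2Inner_symm o (mextDeriv β)]

-- names the `@[deprecated]` record `l2Inner_hodgeLaplacian_comm` on purpose (verdict clean-up 2026-08-15); REMOVE-WHEN the
-- record is deleted from `L2HodgeTheory.lean`
set_option linter.deprecated false in
/-- **Bridge to the named fact as declared.** In the presence of the intended instances
(`[CompactSpace M] [I.Boundaryless]`, continuous and `C^∞` metric), the over-general named fact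
`l2Inner_hodgeLaplacian_comm o` of `L2HodgeTheory.lean` holds (its body quantifies `ho`, `h`,
`α`, `β`, `hα`, `hβ` itself). Warner (1983), Prop. 6.2, Corollary, p. 221.
[cite: WarnerGTM94, Prop. 6.2 Corollary, p. 221] -/
theorem l2Inner_hodgeLaplacian_comm_of_compactSpace :
    l2Inner_hodgeLaplacian_comm (k := k) (m := m) o :=
  fun ho h _ _ hα hβ ↦ l2Inner_hodgeLaplacian_comm_of_isSmoothForm o ho h hα hβ

end Integral

/-! ### The corrected named fact -/

section CorrectedFact

/-- **Warner's Corollary to Proposition 6.2 as a closed named fact, correctly stated.** On a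
compact oriented Riemannian manifold without boundary, the Hodge Laplacian `Δ = dδ + δd` is
symmetric for the `L²` inner product `⟨α, β⟩ = ∫_M α ∧ *β = ∫_M ⟪α, β⟫ vol` on smooth `k`-forms:
`⟨Δα, β⟩ = ⟨α, Δβ⟩` (F. W. Warner, *Foundations of Differentiable Manifolds and Lie Groups*,
GTM 94 (1983), Prop. 6.2, Corollary (5), p. 221; "throughout this chapter `M` will be a compact
oriented Riemannian manifold", p. 220; the proof is `⟨Δα, β⟩ = ⟨δα, δβ⟩ + ⟨dα, dβ⟩` from
Prop. 6.2). **Correction** of the named fact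
`Literature.NumberTheory.Transcendental.l2Inner_hodgeLaplacian_comm` of `L2HodgeTheory.lean`: that
`def … : Prop` was written after
`variable [CompactSpace M] [I.Boundaryless] [IsContinuousRiemannianBundle E _]
[IsContMDiffRiemannianBundle I ∞ E _]`, but a `def` does not abstract unused section instances, so
its elaborated statement binds only `[T2Space M] [SigmaCompactSpace M] [IsManifold I ∞ M]
[RiemannianBundle _]` (besides the linear-algebra and measurability instances on `E`): it
quantifies over non-compact manifolds, manifolds with boundary and fibre metrics of no
regularity — and in that generality it is **false**: on `M = ℝ` (`𝓘(ℝ, ℝ)`, flat metric, constant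
orientation, `n = 1`, `k = 0`), with `α = 1` and `β = g` a smooth function whose derivative is a
smooth transition from `0` to `1`, `Δα = 0` while `⟪α, Δβ⟫ = -∫_ℝ g'' vol = ∓c ≠ 0` — the integrand
`-g'' vol` is a compactly supported smooth top form, for which the partition-of-unity `finsum`
defining `MForm.integral` is an honest finite sum computing the Lebesgue integral (details in the
module docstring). Here the hypotheses `[CompactSpace M] [I.Boundaryless]
[IsContinuousRiemannianBundle E _] [IsContMDiffRiemannianBundle I ∞ E _]` are binders *of the
statement*; it is discharged by `l2Inner_hodgeLaplacian_comm_of_isClosedManifold_holds`, and the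
usable form is `Literature.NumberTheory.Transcendental.l2Inner_hodgeLaplacian_comm_of_isSmoothForm`.
[cite: WarnerGTM94, Prop. 6.2 Corollary, p. 221] -/
def l2Inner_hodgeLaplacian_comm_of_isClosedManifold : Prop :=
  ∀ {E : Type*} [NormedAddCommGroup E] [NormedSpace ℝ E] [FiniteDimensional ℝ E] {n : ℕ}
    [Fact (finrank ℝ E = n)] [MeasurableSpace E] [BorelSpace E]
    {H : Type*} [TopologicalSpace H] {I : ModelWithCorners ℝ E H}
    {M : Type*} [TopologicalSpace M] [ChartedSpace H M] [T2Space M] [CompactSpace M]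
    [IsManifold I ∞ M] [I.Boundaryless] [RiemannianBundle (fun x : M ↦ TangentSpace I x)]
    [IsContinuousRiemannianBundle E (fun x : M ↦ TangentSpace I x)]
    [IsContMDiffRiemannianBundle I ∞ E (fun x : M ↦ TangentSpace I x)] {k m : ℕ}
    (o : (x : M) → Orientation ℝ (TangentSpace I x) (Fin n)),
    IsSmoothForm (riemannianVolumeForm o) → ∀ (h : k + m = n) {α β : MForm I M ℝ k},
      IsSmoothForm α → IsSmoothForm β →
        l2Inner o (hodgeLaplacian o k m h α) β = l2Inner o α (hodgeLaplacian o k m h β)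

/-- **Discharge** of `l2Inner_hodgeLaplacian_comm_of_isClosedManifold` (the corrected form of the
named fact `l2Inner_hodgeLaplacian_comm`): immediate from
`l2Inner_hodgeLaplacian_comm_of_isSmoothForm`. Warner (1983), Prop. 6.2, Corollary, p. 221.
[cite: WarnerGTM94, Prop. 6.2 Corollary, p. 221] -/
theorem l2Inner_hodgeLaplacian_comm_of_isClosedManifold_holds :
    l2Inner_hodgeLaplacian_comm_of_isClosedManifold :=
  fun o ho h _ _ hα hβ ↦ l2Inner_hodgeLaplacian_comm_of_isSmoothForm o ho h hα hβ

end CorrectedFact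

end Literature.NumberTheory.Transcendental
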